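import Literature.Topology.FourManifolds.RebuildUpperArchFormulas
import Literature.Topology.FourManifolds.RebuildLowerArchFormulas
import HarnessLib

/-!
# Values of the rebuilt knot on its fundamental domain

Topic `Literature/Topology/FourManifolds`; fact seat `provefact-IsStrictHandleSlide.isSurgery`
(R. C. Kirby, *The Topology of 4-Manifolds*, LNM 1374 (1989), Ch. I §4, Fig. 4.2; remaining content:
the named fact (S) `Literature.Topology.FourManifolds.FramedLink.IsStrictHandleSlide.slideModel`).
Point values of `BandCore.rebuild` at `circlePt t`, `t` in the fundamental domain
`[alo, alo + 1)`, as points of `S³` (the library states them in `ℝ⁴` through `pieceFun`): the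
lower arch `band (cLo t)` on `[alo, tlo]`, the push-off piece `B (circlePt (ψ t))` on
`(tlo - ε, thi + ε')`, the upper arch `band (cUp t)` on `[thi, ahi)`, the source `A (circlePt t)`
on `(ahi - ε', alo + 1)` and on `[alo, alo + ε)`. Also: every point of the circle is
`circlePt t` with `t` in any prescribed unit interval `[a, a + 1)`.

## References

* R. C. Kirby, *The Topology of 4-Manifolds*, LNM 1374, Springer (1989), Ch. I §4. [Kirby1989]
-/

open scoped Manifold ContDiff Topology
open Function Set Metric Real

noncomputable section

namespace Literature.Topology.FourManifolds

/-- Local notation: `𝔼 n` is the model Euclidean space. -/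
local notation "𝔼 " n:arg => EuclideanSpace ℝ (Fin n)
/-- Local notation: `𝕊 n` is the unit sphere in `𝔼 (n+1)`. -/
local notation "𝕊 " n:arg => (Metric.sphere (0 : EuclideanSpace ℝ (Fin (n + 1))) 1)

namespace BandCore

variable {A B : Knot} {avoid : Set (𝕊 3)} (c : BandCore A B avoid) (hAB : Disjoint (range ⇑A) (range ⇑B))

/-- The rebuilt knot on the fundamental domain, read through `pieceFun`. [folklore] -/
theorem coe_rebuild_circlePt_of_mem {t : ℝ} (ht : t ∈ Ico c.alo (c.alo + 1)) :
    ((c.rebuild hAB (circlePt t) : 𝕊 3) : 𝔼 4) = c.pieceFun t := by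
  rw [c.coe_rebuild_circlePt hAB, rebuildCurve, c.red_eq_sub (n := 0) (by simpa using ht)]; simp

/-- `thi_add_lt` (auxiliary). [folklore] -/
theorem thi_add_lt : c.thi + c.epsHi < c.alo + 1 := by
  obtain ⟨h01, h12, h23, h34, h45, h56, h67, h78⟩ := c.marks_lt
  have := c.epsHi_bounds.2.1; linarith [c.thi_add_lt_ahi_sub]

/-- **The push-off piece**: on `(tlo - ε, thi + ε')`, `rebuild (circlePt t) = B (circlePt (ψ t))`. [folklore] -/
theorem rebuild_circlePt_eq_B {t : ℝ} (ht : t ∈ Ioo (c.tlo - c.epsLo) (c.thi + c.epsHi)) :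
    c.rebuild hAB (circlePt t) = B (circlePt (c.psi t)) := by
  obtain ⟨h01, h12, h23, h34, h45, h56, h67, h78⟩ := c.marks_lt
  have hε := c.epsLo_pos'; have := c.alo_add_lt_tlo_sub; have := c.thi_add_lt
  have hdom : t ∈ Ico c.alo (c.alo + 1) := ⟨by linarith [ht.1], by linarith [ht.2]⟩
  apply Subtype.ext
  rw [c.coe_rebuild_circlePt_of_mem hAB hdom]
  rcases lt_or_ge t c.thi with h | h
  · rw [c.pieceFun_eq_B ⟨ht.1, h⟩]; rfl
  · rw [c.pieceFun_eq_B' ⟨by linarith, ht.2⟩]; rfl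

/-- **The lower arch**: on `[alo, tlo]`, `rebuild (circlePt t) = band (cLo t)`. [folklore] -/
theorem rebuild_circlePt_eq_cLo {t : ℝ} (ht : t ∈ Icc c.alo c.tlo) : c.rebuild hAB (circlePt t) = c.band (c.cLo t) := by
  obtain ⟨h01, h12, h23, h34, h45, h56, h67, h78⟩ := c.marks_lt
  have := c.thi_add_lt; have := c.epsHi_bounds.1
  rcases lt_or_eq_of_le ht.2 with h | h
  · apply Subtype.ext
    rw [c.coe_rebuild_circlePt_of_mem hAB ⟨ht.1, by linarith⟩, c.pieceFun_of_lt_tlo h]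
  · rw [h, c.rebuild_circlePt_eq_B hAB ⟨by linarith [c.epsLo_pos'], by linarith⟩,
      c.band_cLo_eq_B ⟨by linarith [c.epsLo_pos'], c.tlo_marksB.1.le⟩]

/-- **The upper arch**: on `[thi, ahi)`, `rebuild (circlePt t) = band (cUp t)`. [folklore] -/
theorem rebuild_circlePt_eq_cUp {t : ℝ} (ht : t ∈ Ico c.thi c.ahi) : c.rebuild hAB (circlePt t) = c.band (c.cUp t) := by
  obtain ⟨h01, h12, h23, h34, h45, h56, h67, h78⟩ := c.marks_lt
  apply Subtype.ext
  rw [c.coe_rebuild_circlePt_of_mem hAB ⟨by linarith [ht.1], by linarith [ht.2]⟩, c.pieceFun_of_thi_le ht.1 ht.2]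

/-- **The source piece**: on `(ahi - ε', alo + 1)`, `rebuild (circlePt t) = A (circlePt t)`. [folklore] -/
theorem rebuild_circlePt_eq_A {t : ℝ} (ht : t ∈ Ioo (c.ahi - c.epsHi) (c.alo + 1)) : c.rebuild hAB (circlePt t) = A (circlePt t) := by
  obtain ⟨h01, h12, h23, h34, h45, h56, h67, h78⟩ := c.marks_lt
  have := c.epsHi_bounds.2.1; have := c.thi_add_lt_ahi_sub
  apply Subtype.ext
  rw [c.coe_rebuild_circlePt_of_mem hAB ⟨by linarith [ht.1], ht.2⟩, c.pieceFun_eq_A ht]; rfl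

/-- **The source piece at the wrap point**: on `[alo, alo + ε)`, `rebuild (circlePt t) = A (circlePt t)`. [folklore] -/
theorem rebuild_circlePt_eq_A' {t : ℝ} (ht : t ∈ Ico c.alo (c.alo + c.epsLo)) : c.rebuild hAB (circlePt t) = A (circlePt t) := by
  obtain ⟨h01, h12, h23, h34, h45, h56, h67, h78⟩ := c.marks_lt
  have := c.alo_add_lt_tlo_sub; have := c.epsLo_pos'
  apply Subtype.ext
  rw [c.coe_rebuild_circlePt_of_mem hAB ⟨ht.1, by linarith [ht.2]⟩, c.pieceFun_eq_A' ht]; rfl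

end BandCore

end Literature.Topology.FourManifolds
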